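import Summits.MatrixMultiplication.OmegaCensus.BoxBadC3C3C4Config

/-!
# ω-census, family (b3): conjecture C9 (b) — the `D₂₄` CONFIGURATION (an element of order `3` inverted by `x`, centralised by `y`, `[x,y]` a central involution) is box-useless

HONEST FRAMING (pub-omega census; verbatim): lottery ticket; floor = certified bounds/negative ranges.
Census BOOKKEEPING (conjecture C9 of the cell, STRUCTURE.md §2; pub-omega kernel-l4 gen 16, task K-5; third client of
`BoxKeyLiftModel`).  This is THE configuration of the centre-lifting step of the non-nilpotent analysis: a box-useful `G`
whose central quotient `G/Z(G)` has centre index `6` (or is of class `𝒞₂`) but `Z₂(G) > Z(G)` contains it.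

**Theorem (`D24Config.not_boxUseful`).** Let `a, x, y, c ∈ G` with `a³ = 1 ≠ a`, `x a x⁻¹ = a⁻¹`, `y a = a y`,
`x y x⁻¹ y⁻¹ = c` with `c² = 1 ≠ c` and `c` commuting with `a, x, y` (NOTHING is assumed on the orders of `x, y`).  Then `G`
is NOT box-useful: the box `G × {1, y, xy} × {1, xy, a²}` carries `(11/6)|G|` independent cells — key lift over
`N = ⟨a, c⟩ ≅ C₆` with an `11`-element pattern (`5·11 = 55 ≥ 54 = 9·6`), found by the seat's exact key-graph search
(`11` is optimal for this key graph; `D₂₄` has `α = 44 = 4·11` exactly) and checked by `decide` in the model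
`Multiplicative (ZMod 3) × Multiplicative (ZMod 2)`; the `81` gauge words by one simp normal form.
**Corollaries.** The three minimal bad groups of order `24` with centre `C₂` and central quotient `D₁₂` — `D₂₄`
(`a = ρ⁴, x = σ, y = ρ³`), `Dic₆`, `C₃ ⋊ D₈` — in ONE uniform statement, and every `C₃ ⋊ Q` with `Q` a non-abelian
`2`-group acting through a character (`S₃ × D₈`, `S₃ × Q₈`, `C₃ ⋊ Q₁₆`, …).  Nothing here is progress on `ω`.
-/

namespace Summit.MatrixMultiplication.OmegaCensus

open Finset ProductBoxBound KeyLift KleinRot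

namespace D24Config

/-- The coordinate model `M = C₃ × C₂` (multiplicative). [folklore] -/
abbrev M := Multiplicative (ZMod 3) × Multiplicative (ZMod 2)

/-- Coordinates `v p q = (a^p, c^q)` in the model. [folklore] -/
def v (p : ZMod 3) (q : ZMod 2) : M := (Multiplicative.ofAdd p, Multiplicative.ofAdd q)

/-- Conjugation by `x` in coordinates: `(p, q) ↦ (-p, q)`. [folklore] -/
def σx : M →* M where
  toFun m := (m.1⁻¹, m.2)
  map_one' := by decide
  map_mul' := by decide

/-- `σx` is an involution. [folklore] -/
theorem σx_σx : ∀ m, σx (σx m) = m := by decide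

/-- The gauge table of the box `{1, y, xy} × {1, xy, a²}` in coordinates (machine-generated from the model). [folklore] -/
def γ : Three → Three → Three → Three → M
  | .i0, .i0, .i0, .i0 => v 0 0
  | .i0, .i0, .i0, .i1 => v 0 0
  | .i0, .i0, .i0, .i2 => v 0 0
  | .i0, .i0, .i1, .i0 => v 0 0
  | .i0, .i0, .i1, .i1 => v 0 1
  | .i0, .i0, .i1, .i2 => v 0 0
  | .i0, .i0, .i2, .i0 => v 0 0
  | .i0, .i0, .i2, .i1 => v 0 0
  | .i0, .i0, .i2, .i2 => v 1 0
  | .i0, .i1, .i0, .i0 => v 0 0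
  | .i0, .i1, .i0, .i1 => v 0 0
  | .i0, .i1, .i0, .i2 => v 2 0
  | .i0, .i1, .i1, .i0 => v 0 0
  | .i0, .i1, .i1, .i1 => v 0 1
  | .i0, .i1, .i1, .i2 => v 2 0
  | .i0, .i1, .i2, .i0 => v 0 0
  | .i0, .i1, .i2, .i1 => v 0 0
  | .i0, .i1, .i2, .i2 => v 0 0
  | .i0, .i2, .i0, .i0 => v 0 0
  | .i0, .i2, .i0, .i1 => v 1 0
  | .i0, .i2, .i0, .i2 => v 0 0
  | .i0, .i2, .i1, .i0 => v 0 0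
  | .i0, .i2, .i1, .i1 => v 1 1
  | .i0, .i2, .i1, .i2 => v 0 0
  | .i0, .i2, .i2, .i0 => v 0 0
  | .i0, .i2, .i2, .i1 => v 1 0
  | .i0, .i2, .i2, .i2 => v 1 0
  | .i1, .i0, .i0, .i0 => v 0 0
  | .i1, .i0, .i0, .i1 => v 0 1
  | .i1, .i0, .i0, .i2 => v 0 0
  | .i1, .i0, .i1, .i0 => v 0 0
  | .i1, .i0, .i1, .i1 => v 0 0
  | .i1, .i0, .i1, .i2 => v 0 0
  | .i1, .i0, .i2, .i0 => v 0 1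
  | .i1, .i0, .i2, .i1 => v 0 0
  | .i1, .i0, .i2, .i2 => v 1 1
  | .i1, .i1, .i0, .i0 => v 0 0
  | .i1, .i1, .i0, .i1 => v 0 1
  | .i1, .i1, .i0, .i2 => v 2 0
  | .i1, .i1, .i1, .i0 => v 0 0
  | .i1, .i1, .i1, .i1 => v 0 0
  | .i1, .i1, .i1, .i2 => v 2 0
  | .i1, .i1, .i2, .i0 => v 0 1
  | .i1, .i1, .i2, .i1 => v 0 0
  | .i1, .i1, .i2, .i2 => v 0 1
  | .i1, .i2, .i0, .i0 => v 0 0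
  | .i1, .i2, .i0, .i1 => v 1 1
  | .i1, .i2, .i0, .i2 => v 0 0
  | .i1, .i2, .i1, .i0 => v 0 0
  | .i1, .i2, .i1, .i1 => v 1 0
  | .i1, .i2, .i1, .i2 => v 0 0
  | .i1, .i2, .i2, .i0 => v 0 1
  | .i1, .i2, .i2, .i1 => v 1 0
  | .i1, .i2, .i2, .i2 => v 1 1
  | .i2, .i0, .i0, .i0 => v 0 0
  | .i2, .i0, .i0, .i1 => v 0 0
  | .i2, .i0, .i0, .i2 => v 2 0
  | .i2, .i0, .i1, .i0 => v 0 1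
  | .i2, .i0, .i1, .i1 => v 0 0
  | .i2, .i0, .i1, .i2 => v 2 1
  | .i2, .i0, .i2, .i0 => v 0 0
  | .i2, .i0, .i2, .i1 => v 0 0
  | .i2, .i0, .i2, .i2 => v 0 0
  | .i2, .i1, .i0, .i0 => v 0 0
  | .i2, .i1, .i0, .i1 => v 0 0
  | .i2, .i1, .i0, .i2 => v 0 0
  | .i2, .i1, .i1, .i0 => v 0 1
  | .i2, .i1, .i1, .i1 => v 0 0
  | .i2, .i1, .i1, .i2 => v 0 1
  | .i2, .i1, .i2, .i0 => v 0 0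
  | .i2, .i1, .i2, .i1 => v 0 0
  | .i2, .i1, .i2, .i2 => v 1 0
  | .i2, .i2, .i0, .i0 => v 0 0
  | .i2, .i2, .i0, .i1 => v 2 0
  | .i2, .i2, .i0, .i2 => v 2 0
  | .i2, .i2, .i1, .i0 => v 0 1
  | .i2, .i2, .i1, .i1 => v 2 0
  | .i2, .i2, .i1, .i2 => v 2 1
  | .i2, .i2, .i2, .i0 => v 0 0
  | .i2, .i2, .i2, .i1 => v 2 0
  | .i2, .i2, .i2, .i2 => v 0 0

/-- The `11`-element key pattern (machine-found; `5·11 ≥ 9·6`). [folklore] -/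
def T₀ : Finset (M × Three × Three) :=
  {(v 1 1, .i0, .i0), (v 2 1, .i0, .i2), (v 1 0, .i1, .i0), (v 2 1, .i1, .i1), (v 2 0, .i1, .i2), (v 0 1, .i2, .i0), (v 1 0, .i2, .i0), (v 0 0, .i2, .i1), (v 2 0, .i2, .i1), (v 0 0, .i2, .i2), (v 2 1, .i2, .i2)}

/-- The pattern is independent in the model key graph. [folklore] -/
theorem T₀_key : ∀ t ∈ T₀, ∀ t' ∈ T₀, t ≠ t' → t.1 ≠ γ t.2.1 t.2.2 t'.2.1 t'.2.2 * t'.1 := by decide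

/-- `#T₀ = 11`. [folklore] -/
theorem T₀_card : #T₀ = 11 := by decide

open S3S3Config (val0 val1 val2 inv_eq_sq)
open C3C3C4Config (eq_one_of_sq)

/-- Values in `ZMod 2`. [folklore] -/ theorem val20 : (0 : ZMod 2).val = 0 := rfl
/-- Values in `ZMod 2`. [folklore] -/ theorem val21 : (1 : ZMod 2).val = 1 := rfl

variable {G : Type*} [Group G] {a x y c : G}

section Main

variable (ha : a ^ 3 = 1) (hc : c ^ 2 = 1) (hca : c * a = a * c)

/-- The coordinate homomorphism `ψ (p, q) = a^p c^q`. [folklore] -/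
def ψ (ha : a ^ 3 = 1) (hc : c ^ 2 = 1) (hca : c * a = a * c) : M →* G :=
  MonoidHom.noncommCoprod (cycHom 3 a ha) (cycHom 2 c hc) (fun m n => by
    rw [cycHom_apply, cycHom_apply]
    exact (Commute.pow_pow hca.symm _ _))

/-- `ψ (v p q) = a ^ p.val * c ^ q.val`. [folklore] -/
theorem ψ_v (p : ZMod 3) (q : ZMod 2) : ψ ha hc hca (v p q) = a ^ p.val * c ^ q.val := by
  simp [ψ, v, MonoidHom.noncommCoprod_apply, cycHom_ofAdd]

/-- A homomorphism out of `M` agreeing with another on `(ofAdd 1, 1)` and `(1, ofAdd 1)` is equal to it. [folklore] -/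
theorem hom_ext {f g : M →* G} (h₁ : f (Multiplicative.ofAdd 1, 1) = g (Multiplicative.ofAdd 1, 1))
    (h₂ : f (1, Multiplicative.ofAdd 1) = g (1, Multiplicative.ofAdd 1)) : f = g := by
  refine prod_ext (fun p => ?_) (fun q => ?_)
  · have e := mzmod_ext (f := f.comp (MonoidHom.inl _ _)) (g := g.comp (MonoidHom.inl _ _)) (by simpa using h₁)
    simpa using congrArg (fun φ : Multiplicative (ZMod 3) →* G => φ p) e
  · have e := mzmod_ext (f := f.comp (MonoidHom.inr _ _)) (g := g.comp (MonoidHom.inr _ _)) (by simpa using h₂)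
    simpa using congrArg (fun φ : Multiplicative (ZMod 2) →* G => φ q) e

/-- `ψ` on the two generators. [folklore] -/
theorem ψ_gen : ψ ha hc hca (Multiplicative.ofAdd 1, 1) = a ∧ ψ ha hc hca (1, Multiplicative.ofAdd 1) = c := by
  constructor
  · have := ψ_v ha hc hca 1 0
    simpa [v, val1] using this
  · have := ψ_v ha hc hca 0 1
    simpa [v, val21] using this

/-- Conjugation by `x` in coordinates. [folklore] -/
theorem conj_x (hxa : x * a * x⁻¹ = a⁻¹) (hcx : c * x = x * c) (m : M) :
    x * ψ ha hc hca m * x⁻¹ = ψ ha hc hca (σx m) := by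
  obtain ⟨g1, g2⟩ := ψ_gen ha hc hca
  refine conj_of_hom_eq (hom_ext ?_ ?_) m
  · have e2 : σx (Multiplicative.ofAdd (1 : ZMod 3), 1) = v 2 0 := by decide
    simp only [MonoidHom.comp_apply, MulEquiv.coe_toMonoidHom, MulAut.conj_apply, g1, e2, ψ_v, val2, val20,
      pow_zero, mul_one, hxa, inv_eq_sq ha]
  · have e2 : σx (1, Multiplicative.ofAdd (1 : ZMod 2)) = v 0 1 := by decide
    simp only [MonoidHom.comp_apply, MulEquiv.coe_toMonoidHom, MulAut.conj_apply, g2, e2, ψ_v, val0, val21,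
      pow_zero, pow_one, one_mul, ← hcx, mul_inv_cancel_right]

/-- Conjugation by `y` in coordinates is trivial. [folklore] -/
theorem conj_y (hya : y * a = a * y) (hcy : c * y = y * c) (m : M) :
    y * ψ ha hc hca m * y⁻¹ = ψ ha hc hca (id m) := by
  obtain ⟨g1, g2⟩ := ψ_gen ha hc hca
  refine conj_of_hom_eq (σ := MonoidHom.id M) (hom_ext ?_ ?_) m
  · simp only [MonoidHom.comp_apply, MulEquiv.coe_toMonoidHom, MulAut.conj_apply, g1, MonoidHom.id_apply, hya,
      mul_inv_cancel_right]
  · simp only [MonoidHom.comp_apply, MulEquiv.coe_toMonoidHom, MulAut.conj_apply, g2, MonoidHom.id_apply, ← hcy,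
      mul_inv_cancel_right]

end Main

section Final

variable (ha : a ^ 3 = 1) (hc : c ^ 2 = 1) (hca : c * a = a * c)

/-- `ψ` is injective when `a ≠ 1 ≠ c`. [folklore] -/
theorem ψ_injective (ha1 : a ≠ 1) (hc1 : c ≠ 1) : Function.Injective (ψ ha hc hca) := by
  have ha2 : a ^ 2 ≠ 1 := fun h => ha1 (eq_one_of_sq ha h)
  -- `c ∉ ⟨a⟩`: an element of `⟨a⟩` cubes to `1`, and `c³ = c`
  have hc3 : c ^ 3 = c := by rw [pow_succ, hc, one_mul]
  have key : ∀ i j : ℕ, i < 3 → j < 2 → a ^ i * c ^ j = 1 → i = 0 ∧ j = 0 := by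
    intro i j hi hj h
    interval_cases i <;> interval_cases j
    all_goals try simp only [pow_zero, pow_one, one_mul, mul_one] at h
    · exact ⟨rfl, rfl⟩
    · exact absurd h hc1
    · exact absurd h ha1
    · -- `a c = 1 ⇒ c = a⁻¹ ⇒ c³ = 1 ⇒ c = 1`
      exfalso; apply hc1
      have e : c = a⁻¹ := eq_inv_of_mul_eq_one_right h
      rw [← hc3, e, inv_pow, ha, inv_one]
    · exact absurd h ha2
    · exfalso; apply hc1
      have e : c = (a ^ 2)⁻¹ := eq_inv_of_mul_eq_one_right h
      rw [← hc3, e, inv_pow, ← pow_mul, show 2 * 3 = 3 * 2 by rfl, pow_mul, ha, one_pow, inv_one]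
  rw [injective_iff_map_eq_one]
  rintro ⟨p, q⟩ h
  have h' : a ^ (Multiplicative.toAdd p).val * c ^ (Multiplicative.toAdd q).val = 1 := by
    simpa only [ψ, MonoidHom.noncommCoprod_apply, cycHom_apply] using h
  obtain ⟨hp, hq⟩ := key _ _ (ZMod.val_lt _) (ZMod.val_lt _) h'
  have hp' : Multiplicative.toAdd p = 0 := (ZMod.val_eq_zero _).1 hp
  have hq' : Multiplicative.toAdd q = 0 := (ZMod.val_eq_zero _).1 hq
  rw [show p = 1 from toAdd_eq_zero.mp hp', show q = 1 from toAdd_eq_zero.mp hq']; rfl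

/-- The second box coordinate `Y = {1, y, xy}`. [folklore] -/
def yv (x y : G) : Three → G
  | .i0 => 1 | .i1 => y | .i2 => x * y

/-- The third box coordinate `W = {1, xy, a²}` (`a² = ψ (v 2 0)`). [folklore] -/
def wv (φ : M →* G) (x y : G) : Three → G
  | .i0 => 1 | .i1 => x * y | .i2 => φ (v 2 0)

include ha hc hca in
/-- **The `D₂₄` configuration makes `G` box-useless (ratio `≥ 11/6`).** [folklore] -/
theorem not_boxUseful [Fintype G] [DecidableEq G] (ha1 : a ≠ 1) (hc1 : c ≠ 1) (hxa : x * a * x⁻¹ = a⁻¹)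
    (hya : y * a = a * y) (hxy : x * y * x⁻¹ * y⁻¹ = c) (hcx : c * x = x * c) (hcy : c * y = y * c) :
    ¬ BoxUseful G := by
  classical
  have hinj : Function.Injective (ψ ha hc hca) := ψ_injective ha hc hca ha1 hc1
  have g2 : ψ ha hc hca (v 2 0) = a ^ 2 := by rw [ψ_v]; simp [val2]
  have g0 : ψ ha hc hca (v 0 0) = 1 := by rw [ψ_v]; simp
  have gc : ψ ha hc hca (v 0 1) = c := by rw [ψ_v]; simp [val21]
  have Rx := conj_rule (conj_x ha hc hca hxa hcx)
  have Rxi := conj_rule_inv (conj_x ha hc hca hxa hcx) σx_σx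
  have Ry := conj_rule (conj_y ha hc hca hya hcy)
  have Ry' := conj_rule' (conj_y ha hc hca hya hcy)
  have Ryi := conj_rule_inv (τ := id) (conj_y ha hc hca hya hcy) (fun _ => rfl)
  have Ryi' := conj_rule_inv' (τ := id) (conj_y ha hc hca hya hcy) (fun _ => rfl)
  -- sorting `y` past `x`: `y x = c x y`, `y x⁻¹ = c x⁻¹ y`, `y⁻¹ x = c x y⁻¹`, `y⁻¹ x⁻¹ = c x⁻¹ y⁻¹`
  have hcinv : c⁻¹ = c := by rw [eq_comm, ← mul_eq_one_iff_eq_inv', ← pow_two, hc]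
  have hcxC : Commute c x := hcx
  have hcyC : Commute c y := hcy
  have S1' : y * x = c * (x * y) := by
    have e : y * x = c⁻¹ * (x * y) := by
      calc y * x = (x * y * x⁻¹ * y⁻¹)⁻¹ * (x * y) := by group
        _ = c⁻¹ * (x * y) := by rw [hxy]
    rw [e, hcinv]
  have S1 : ∀ t : G, y * (x * t) = c * (x * (y * t)) := fun t => by rw [← mul_assoc, S1']; group
  have S2' : y * x⁻¹ = c * (x⁻¹ * y) := by
    calc y * x⁻¹ = x⁻¹ * (x * y * x⁻¹ * y⁻¹) * y := by group
      _ = x⁻¹ * c * y := by rw [hxy]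
      _ = c * (x⁻¹ * y) := by rw [show x⁻¹ * c = c * x⁻¹ from (hcxC.inv_right).eq.symm, mul_assoc]
  have S2 : ∀ t : G, y * (x⁻¹ * t) = c * (x⁻¹ * (y * t)) := fun t => by rw [← mul_assoc, S2']; group
  have S4' : y⁻¹ * x⁻¹ = c * (x⁻¹ * y⁻¹) := by
    have e : x * y = c⁻¹ * (y * x) := by rw [S1']; group
    calc y⁻¹ * x⁻¹ = (x * y)⁻¹ := by group
      _ = (y * x)⁻¹ * c := by rw [e]; group
      _ = c * (x⁻¹ * y⁻¹) := by
          rw [show (y * x)⁻¹ = x⁻¹ * y⁻¹ by group]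
          exact ((hcxC.inv_right).mul_right (hcyC.inv_right)).eq.symm
  have S4 : ∀ t : G, y⁻¹ * (x⁻¹ * t) = c * (x⁻¹ * (y⁻¹ * t)) := fun t => by rw [← mul_assoc, S4']; group
  have gc' : c = ψ ha hc hca (v 0 1) := gc.symm
  -- distinctness in the box
  have ha2 : a ^ 2 ≠ 1 := fun h => ha1 (eq_one_of_sq ha h)
  have hy1 : y ≠ 1 := by
    rintro rfl; apply hc1; rw [← hxy]; group
  have hxy1 : x * y ≠ 1 := by
    intro h; apply hc1
    have hy : y = x⁻¹ := eq_inv_of_mul_eq_one_right h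
    rw [← hxy, hy]; group
  have hyxy : y ≠ x * y := by
    intro h; apply hc1
    have hx : x = 1 := by
      have := h.symm; rw [mul_eq_right] at this; exact this
    rw [← hxy, hx]; group
  have hxya : x * y ≠ a ^ 2 := by
    intro h; apply hc1
    have hx : x = a ^ 2 * y⁻¹ := by rw [← h]; group
    have hcomm : Commute y a := hya
    have h2 : Commute y ((a ^ 2)⁻¹) := (hcomm.pow_right 2).inv_right
    rw [← hxy, hx]
    calc a ^ 2 * y⁻¹ * y * (a ^ 2 * y⁻¹)⁻¹ * y⁻¹ = a ^ 2 * (y * (a ^ 2)⁻¹) * y⁻¹ := by group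
      _ = a ^ 2 * ((a ^ 2)⁻¹ * y) * y⁻¹ := by rw [h2.eq]
      _ = 1 := by group
  have hy_inj : Function.Injective (yv x y) := by
    intro i j h
    cases i <;> cases j <;> simp only [yv] at h
    all_goals first | rfl | exfalso
    all_goals first | exact hy1 h.symm | exact hy1 h | exact hxy1 h.symm | exact hxy1 h | exact hyxy h | exact hyxy h.symm
  have hw_inj : Function.Injective (wv (ψ ha hc hca) x y) := by
    intro i j h
    cases i <;> cases j <;> simp only [wv, g2] at h
    all_goals first | rfl | exfalso
    all_goals first | exact hxy1 h.symm | exact hxy1 h | exact ha2 h.symm | exact ha2 h | exact hxya h | exact hxya h.symm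
  have hM : 9 * Fintype.card M ≤ 5 * #T₀ := by
    rw [T₀_card]; simp [M, Fintype.card_prod, ZMod.card]
  refine not_boxUseful_of_model (ψ ha hc hca) hinj (yv x y) (wv (ψ ha hc hca) x y) hy_inj hw_inj rfl rfl
    γ ?_ T₀ T₀_key hM
  -- rules in `ψ`-form (no bare `c`)
  rw [gc'] at S1 S1' S2 S2' S4 S4'
  intro i j i' j'
  cases i <;> cases j <;> cases i' <;> cases j' <;>
  · simp only [yv, wv, γ, gaugeWord, mul_assoc, mul_inv_rev, inv_one, one_mul, mul_one, psi_mul_left, psi_mul,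
      psi_inv, Rx, Rxi, Ry, Ry', Ryi, Ryi', S1, S1', S2, S2', S4, S4', id, mul_inv_cancel_left, mul_inv_cancel,
      map_one]
    first | exact g0.symm | (apply congrArg (ψ ha hc hca); decide)

end Final

end D24Config

end Summit.MatrixMultiplication.OmegaCensus
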